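/-
Copyright: lit-balaban READER/TYPER seat r18 (gen 10).  Statement-level skeleton of a published paper; no proof claims beyond what
the kernel checks below.
-/
import Literature.MathematicalPhysics.QuantumFieldTheory.BalabanImbrieJaffe1984to88.BIJ88CurlyDkLocDecayTorus
import Literature.MathematicalPhysics.QuantumFieldTheory.BalabanImbrieJaffe1984to88.BIJ85Sect72AllTori
import Literature.MathematicalPhysics.QuantumFieldTheory.BalabanImbrieJaffe1984to88.BIJ85Prop12PerTower
import Literature.MathematicalPhysics.QuantumFieldTheory.BalabanImbrieJaffe1984to88.BIJ88CurlyDkLocGradTerm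
import Literature.MathematicalPhysics.QuantumFieldTheory.BalabanImbrieJaffe1984to88.BIJ85Prop12AllTori
import Literature.MathematicalPhysics.QuantumFieldTheory.BalabanImbrieJaffe1984to88.BIJ88Ineq547W1Prime

/-!
# `BalabanImbrieJaffe1984to88.BIJ88CurlyDkLocCloseTorus` — T. Bałaban, J. Imbrie, A. Jaffe, *Effective action and cluster properties of
the abelian Higgs model*, Commun. Math. Phys. **114** (1988) 257–315 [BalabanImbrieJaffe1988], Sect. 2 p. 261 [PDF 5]: the third clause of
the (2.13) sentence, *"and 𝒟_{k,loc} is close to 𝒟_k, see (5.4.3) below"*, PROVED IN KERNEL FORM FOR THE CONCRETE OBJECTS OF RECORD on the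
tori of the series — p11's (I.4.4.4) propagator `𝒟_k = DkE P η_k^d L^k k` and r18's (2.12) `𝒟_{k,loc} = dkLocKer (η_k^d) (L^k) ρ k`:
`|𝒟_k(b,b″) − 𝒟_{k,loc}(b,b″)| ≤ c₀·e^{−c·ρ_k}·e^{−δ′·dist_k(b,b″)}` beyond a threshold, for every radius schedule `ρ` that is positive and
non-increasing along `j < k` (the printed `r(e_j)` is, for `d ≤ 4`), constants from the (I.7.2.2)/(I.7.2.3) constants and `(d, L)` only;
per tower with NO hypothesis, and over ALL tori from [6I] Proposition 1.2 over the all-tori index.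

statement-level skeleton of published theorems with citation tags; proofs where landed; nothing here is a claim about the Yang–Mills mass gap

PDF held: `paper:balaban1988-cmp114-bij-abelian-higgs-effective-action` (journal page = PDF page + 256), p. 261 [PDF 5] (text layer
`p0005.txt` re-read this session); p. 282 [PDF 26]: (5.4.3) and the UNNUMBERED `w′₁`-display following it (text layer `p0026.txt` tl. 4–9,
re-read 2026-08-22) for the use of the clause in §5.4 — the numbered (5.4.7) on that page (tl. 33–34) is the analogous `w₂` bound.

CITATION HEADER (lean-in-tree rule).  Part of the lit-balaban TYPED SKELETON (HOME `run/shared/lean/pub/lit-balaban/`), READER/TYPER seat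
r18 = the C2 §§1–4 fold owner (unit `lit-balaban-r18`, gen 10; TAKING line HOME/STATUS.md 2026-08-21T21:35:10Z).  Row served: **C2.Eq2.13**
(`HOME/lit-balaban-r18/ROWS-C2.md`), third p. 261 clause — the first clause (decay) is p08's `BIJ88MultiscaleDecay223(Torus)` / p08 gen 9's
`BIJ88CurlyDkLocDecayTorus` + `BIJ88OpDecay213DkLocTorus` for the concrete object, the second (finite range) r18's
`BIJ88CurlyDkLocTorus.vanishes_dkLocKer`; r16's row C2.Eq5.4.7 (the w′₁-bound built on `𝒟_k − 𝒟_{k,loc}`) is NOT touched.  Decls used BY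
NAME (nothing restated): p08's `BIJ85CurlyDkDecayTorus.dkKernel_eq_sum` (the (I.4.4.4) triple sum), `BIJ88Decay216Torus.triple_sum_le`,
`BIJ88CurlyDkLocDecayTorus.abs_sum_scales_le` (the multiscale step) and `abs_hlKer_le_of_sup`, `BIJ88Ineq217Ineq722Torus.ofLp_HkE_single` /
`exists_bound_of_ineq722`; r18's `BIJ88CurlyDkLocTorus` (`hKer`, `hlKer`, `cKer`, `clKer`, `dkLocKer`, `kdist`, `hdist`, `cKer_ambient_eq`,
`clKer_ambient_eq_apply`, `hlKer_apply`); p13's `BIJ88Cutoffs21.cutoffProfile_eq_one`; p09's `BIJ88ClocEstimatesTorus.cloc_estimates`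
((2.5)–(2.7)-analogues for `C^{(k)}_{loc}`, all tori, hypothesis-free); p16's `BIJ85Sect72AllTori.exists_absH_le_allTori_of_prop12Printed` /
`abs_H_zero_le` and `BIJ85Prop12PerTower.prop12Printed_levStd_deltaA`; p09's `BIJ85Ineq722DeltaA.ineq722_deltaA_of_prop12Printed`.

THE PRINTED TEXT (p. 261 [PDF 5], verbatim).  *"This propagator derives its regularity and decay from that of C^{(j)}_{loc} and H_{k,loc}.
Thus |(𝒟_{k,loc}f)(b)| ≦ ce^{−c dist(supp f, b)}‖f‖_∞ (2.13) and similarly for derivatives of 𝒟_{k,loc} and Hölder derivatives of order less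
than 2. Furthermore, 𝒟_{k,loc}(b₁,b₂) = 0 for dist(b₁,b₂) ≧ ½r(e_k), and 𝒟_{k,loc} is close to 𝒟_k, see (5.4.3) below."*; p. 260 (2.7)
*"|H_{k,loc}(b,b′) − H_k(b,b′)| ≦ e^{−cr(e_k)}e^{−c dist(b,b′)}"*; p. 261 *"We have estimates analogous to (2.5)–(2.7) for C^{(k)}_{loc}"*;
p. 282, the unnumbered `w′₁`-display after (5.4.3) *"… ≦ Σ_{j}(L^jη)^{…}e^{−cr(e_j)}e^{−c dist(p,b′)} ≦ e^{−cr(e_k)}e^{−c dist(p,b′)}"* (the use of the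
clause; the numbered (5.4.7) below it, *"|w₂(x,b)| ≦ exp(−cr(e_k))exp(−c dist(x,b))"*, is the `w₂` bound of the same shape).

THE READING (kind «model instance»; nothing new).  `𝒟_k(b,b″) = Σ_{j<k}Σ_{b₁,b₂}H_j(b,b₁)C^{(j),L^jη}(b₁,b₂)H_j(b″,b₂)` (p08's `dkKernel_eq_sum`,
kernels `hKer`/`cKer` of r18's file at the printed weights `(η_k^d, L^k)`), `𝒟_{k,loc}(b,b″)` = the same with `H_{j,loc} = ζ_jH_j` (radii
`ρ_j/16 < ρ_j/8`) and `C^{(j),L^jη}_{loc}` (radius `ρ_j/4`) (`dkLocKer`).  Per scale,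
`H C H − H_lC_lH_l = (H − H_l)CH + H_l(C − C_l)H + H_lC_l(H − H_l)`; the small factors: `H_j − H_{j,loc} = (1 − ζ_j)H_j` vanishes within
`ρ_j/16` hence `|H_j − H_{j,loc}| ≤ Me^{−(δ/2)(ρ_j/16)}e^{−(δ/2)dist}` ((2.7) for this object, `abs_hKer_sub_hlKer_le`), and `|C^{(j)} − C^{(j)}_{loc}| ≤
M_Ce^{−(δ_C/4)ρ_j}e^{−δ_C|b₁−b₂|}` (p09's (2.7)-analogue at `R = ρ_j/4`, rescaled by `(L^{k−j})^{d−2}`); each of the three products is a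
two-kernel instance of p08's per-scale estimate (`abs_triple_le₂`), the scale sum is p08's `abs_sum_scales_le`, and `e^{−cρ_j} ≤ e^{−cρ_k}` for a
non-increasing schedule.

WHAT IS PROVED (kernel-checked; theorems only; 0 `sorry`; no new definition, no named fact; standard axioms):
* §1 (the two-kernel per-scale estimate `abs_triple_le₂` is p08 gen 9's `BIJ88CurlyDkLocGradTerm.abs_triple_le₂`, consumed BY NAME —
  v1.1 re-file), `abs_hKer_sub_hlKer_le` ((2.7) for `H_{j,loc} = ζ_jH_j`: smallness `e^{−(δ/2)R₁}` from
  `ζ_j = 1` within `R₁`), `abs_cKer_sub_clKer_ambient_le` (the rescaled C-difference).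
* §2 `dk_sub_dkLoc_eq_sum` (the difference as the scale sum), `abs_diffTerm_le` (the scale-`j` difference term via the three telescoped
  products) and **`abs_dk_sub_dkLoc_le`**: for `dist_k(b,b″) ≥ 2`,
  `|𝒟_k(b,b″) − 𝒟_{k,loc}(b,b″)| ≤ 3M²M_C·d²e^{a/2}K(a)²·(d−1)!/a^{d−1}·e^{−cρ_k}·e^{−(a/2)dist_k(b,b″)}`, `a = min(δ/2, δ_C)/2`, `c = min(δ/32, δ_C/4)`,
  GIVEN the sup member of (I.7.2.2) for every `H_j` (`j < k`; constants `M, δ`), bounds `M_Ce^{−δ_C|·|}` for p09's `Cmat`/`Cloc` of record and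
  `M_Ce^{−(δ_C/4)ρ_j}e^{−δ_C|·|}` for their difference at the radii `ρ_j/4`, and a schedule with `0 < ρ_j`, `ρ_k ≤ ρ_j` (`j < k`).
* §3 per tower: `cSide_of_cloc_estimates` (the three C-side inputs from p09's `cloc_estimates`, constants `M_Ce^{4δ₀L}(1+L)²`, rate `δ₀/2`),
  `close_dkLoc_dk_torus_of_ineq722` (from r15's typed (I.7.2.2) for p09's kernel family; C-side HYPOTHESIS-FREE by p09's
  `cloc_estimates`) and **`close_dkLoc_dk_torus`** — NO HYPOTHESIS AT ALL (per-tower [6I] Prop. 1.2 is finite bookkeeping, p16's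
  `prop12Printed_levStd_deltaA`; typing note G-C1-07): `∃ R₀ c₀ c δ′`, `0 < c`, `0 < δ′`, `0 ≤ c₀`, `∀ k ≤ m + K ∀ ρ` (positive, non-increasing
  below `k`) `∀ b b″`, `R₀ ≤ dist_k(b,b″) → |𝒟_k(b,b″) − 𝒟_{k,loc}(b,b″)| ≤ c₀e^{−cρ_k}e^{−δ′dist_k(b,b″)}`.
* §4 over all tori: **`close_dkLoc_dk_allTori_of_prop12Printed`** — ONE `(R₀, c₀, c, δ′)` for EVERY torus `P` (`P.d = d`, `P.L = L`), every
  `k ≤ m + K` and every admissible schedule, from `B5.Prop12Printed` over the all-tori index (p16's all-tori `|H|` member + `H_0 = I`, p09's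
  all-tori `cloc_estimates`).
HONEST SCOPE.  (i) Kernel form BEYOND A THRESHOLD (`dist_k ≥ R₀ = 2`): near the diagonal the scale sum carries `Σ_{j<k}(L^{k−j})^{d−2}` (as for
(2.13) itself, p08's `abs_dkLocKer_le_diag`); the printed use (the `w′₁`-display after (5.4.3), p. 282) is an operator statement with the `η^d`
pairing weight, two derivatives and the `∂*ε*δΠ` dressing, on r16's row C2.Eq5.4.7 — NOT proved here.  POINTER (v1.3, ref-5 L-g34 (c)): the undressed
OPERATOR form of this closeness for the same objects (η^d-weighted action, every `b`, no threshold) is landed as p08's `BIJ88OpCloseDkLocTorus`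
(p311108; v1.1 p314986), which imports this file, and its η-derivative as p08's `BIJ88OpCloseDkLocGradTorus` (p312648; v1.1 p315194).
(ii) The smallness is `e^{−cρ_k}` for any positive schedule non-increasing in `j < k`; for the
printed `ρ_j = r(e_j)` ((2.2)–(2.3), `d ≤ 4`) this is `e^{−cr(e_k)}`; the monotonicity of `r(e_j)` is displayed as a hypothesis, not derived here.
(iii) `U = 1`, real fields, tori of the series, `k ≤ m + K`, distances as in the cited files (their DIVERGENCE notes apply verbatim).  NOT summit
progress.  Unit `lit-balaban-r18` (literature-prover-lit-balaban-r18-g10-0), 2026-08-21.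

RE-FILE NOTE (v1.1).  AUTHOR OF RECORD: r18 gen 10 (filed as p306924, bounced `dedup.landed` only because its §1 re-proved the two-kernel
estimate that had meanwhile landed as p08's `BIJ88CurlyDkLocGradTerm.abs_triple_le₂`, p306544).  This v1.1 is r18's text VERBATIM except: that
lemma (and its private summation helper) deleted and imported/opened by name instead; courtesy re-file by p08 gen 9
(literature-prover-lit-balaban-p08-g9-0, TAKING (J) HOME/STATUS.md) to unblock the operator-form files that import this one; all FQNs unchanged.

v1.2 (r18 gen 11, literature-prover-lit-balaban-r18-g11-0, 2026-08-22; APPEND-ONLY §5, theorems only).  (a) HONEST SCOPE (ii) DISCHARGED for the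
printed schedule: with `ρ_j = r(e_j)` (r18's `BIJ88CurlyDkLocTorus.rSched`, (2.2)–(2.3)) the two schedule hypotheses (`0 < ρ_j`, `ρ_k ≤ ρ_j`
for `j < k`) FOLLOW from `log e_k⁻¹ > 0` (i.e. `e_k < 1`), `0 ≤ r` and `d ≤ 4` (`rSched_pos_of_le`, `rSched_anti`, via p08's
`BIJ88Ineq547W1Prime.log_inv_eK_mono` BY NAME), so the smallness is literally the printed `e^{−cr(e_k)}`: `close_dkLoc_dk_torus_rSched`.  (b) The
all-tori statement made HYPOTHESIS-FREE by p19 gen 6's bridge theorem `BIJ85Prop12AllTori.prop12Printed_allTori` ([6I] Prop. 1.2 over the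
all-tori index is a THEOREM of the tree): `close_dkLoc_dk_allTori` (only `2 ≤ d`, `L` odd `> 1`) and `close_dkLoc_dk_allTori_rSched`.

v1.3 (r18 gen 13, literature-prover-lit-balaban-r18-g13-0, 2026-08-22; DOCSTRING-ONLY, declarations byte-identical to v1.2).  The p. 282 locator
relabelled in four places: the `Σ_j` display this header quoted as «(5.4.7)» is the UNNUMBERED `w′₁`-display following (5.4.3) (CMP 114 p. 282
[PDF 26] tl. 4–9); the numbered (5.4.7) (tl. 33–34) is the `w₂` bound — referee ref-5 L-g34 (b) (the same relabel in p08's two operator-form files,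
p314986 / p315194), lead relay HOME/STATUS.md 2026-08-22T02:11:37Z; plus the discretionary HONEST SCOPE (i) pointer line L-g34 (c).
-/

open scoped BigOperators RealInnerProductSpace

namespace Literature.MathematicalPhysics.QuantumFieldTheory.BalabanImbrieJaffe1984to88.BIJ88CurlyDkLocCloseTorus

open Balaban1983to89 hiding Site Plaq
open Balaban1983to89.LatticeFieldCalculus
open BIJ88Ineq217Ineq722Torus (ofLp_HkE_single exists_bound_of_ineq722 torusKernelData_gradH_nonneg)
open BIJ88Decay216Torus (triple_sum_le)
open BIJ85AxialPropagator411 (toE)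
open BIJ85Prop521Torus BIJ85Prop522Torus BIJ85Sigma422Eta
open BIJ85Sect7Statements BIJ85Ineq722Torus
open BIJ85Ineq722DeltaA (deltaAData ineq722_deltaA_of_prop12Printed)
open BIJ85Ineq722ProofPart2 (settingOf)
open BIJ88ClocFactorsTorus (Cmat distB distB_apply)
open BIJ88ClocEstimatesTorus (Cloc cloc_estimates)
open BIJ88Cutoffs21 (cutoff cutoffProfile cutoff_nonneg cutoff_le_one cutoffProfile_eq_one)
open BIJ85CurlyDkDecayTorus (dkKernel_eq_sum)
open BIJ88CurlyDkLocDecayTorus (abs_sum_scales_le abs_hlKer_le_of_sup)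
open BIJ85Sect72AllTori (exists_absH_le_allTori_of_prop12Printed abs_H_zero_le)
open BIJ85Prop12PerTower (prop12Printed_levStd_deltaA)
open BIJ88CurlyDkLocTorus
open BIJ88CurlyDkLocGradTerm (abs_triple_le₂)
-- inside this namespace the bare `Site`/`Plaq` are the `ℤ^d` carriers of the QFT root; the torus ones are renamed:
open Balaban1983to89 renaming Site → TSite, Plaq → TPlaq

noncomputable section

variable {P : Params}

/-! ## §1  The per-scale pieces: a two-kernel triple estimate and the two small differences -/

/-- `0 < L^n`. [folklore] -/
private theorem cast_pow_L_pos' (n : ℕ) : (0 : ℝ) < (P.L : ℝ) ^ n := pow_pos P.cast_L_pos n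

/-- **(2.7) FOR THE OBJECT OF RECORD `H_{j,loc} = ζ_jH_j`**: with `ζ_j = cutoff R₁ R₀ dist`, `R₁ < R₀`, and the sup member of (I.7.2.2) for `H_j`
(`|H_j(b,b₁)| ≤ Me^{−δ dist(b,b₁)}`), the difference `H_j − H_{j,loc} = (1 − ζ_j)H_j` VANISHES for `dist(b,b₁) ≤ R₁` and satisfies
`|H_j(b,b₁) − H_{j,loc}(b,b₁)| ≤ Me^{−(δ/2)R₁}·e^{−(δ/2)dist(b,b₁)}` everywhere — the printed *"|H_{k,loc} − H_k| ≦ e^{−cr(e_k)}e^{−c dist}"* with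
`R₁ = r(e_k)/16`. [cite: BalabanImbrieJaffe1988, (2.7) p.260] -/
theorem abs_hKer_sub_hlKer_le {j : ℕ} (hj : j ≤ P.m + P.K) {w c : ℝ} (hw : 0 < w) (hc : c ≠ 0) {a : ℝ} (ha : 0 < a) {δ M : ℝ}
    (hδ : 0 ≤ δ)
    (hH : ∀ (μ ν : Fin P.d) (x : TSite P 0) (y : TSite P j),
      |(torusRep P j (deltaAData hj a)).H (x, μ) (y, ν)| ≤ M * Real.exp (-(δ * distEU P j x y)))
    {R₁ R₀ : ℝ} (hR : R₁ < R₀) (b₀ : PBond P 0) (b₁ : PBond P j) :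
    |hKer (P := P) w c j b₀ b₁ - hlKer (P := P) w c R₁ R₀ j b₀ b₁| ≤
      M * Real.exp (-(δ / 2 * R₁)) * Real.exp (-(δ / 2 * distEU P j b₀.src b₁.src)) := by
  have hM : 0 ≤ M := by
    have h := hH b₀.dir b₁.dir b₀.src b₁.src
    exact (mul_nonneg_iff_of_pos_right (Real.exp_pos _)).1 ((abs_nonneg _).trans h)
  by_cases hnear : hdist (P := P) j b₀ b₁ ≤ R₁
  · -- within `R₁` the cutoff is `1`: the difference vanishes
    have hζ : cutoff R₁ R₀ (hdist (P := P) j) b₀ b₁ = 1 := cutoffProfile_eq_one hR hnear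
    rw [hlKer_apply, hζ, one_mul, sub_self, abs_zero]
    positivity
  · -- beyond `R₁`: `|(1 − ζ)H| ≤ |H| ≤ Me^{−δ dist} ≤ Me^{−(δ/2)R₁}e^{−(δ/2)dist}`
    have hfar : R₁ ≤ distEU P j b₀.src b₁.src := (not_le.1 hnear).le
    have e : hKer (P := P) w c j b₀ b₁ = (torusRep P j (deltaAData hj a)).H (b₀.src, b₀.dir) (b₁.src, b₁.dir) :=
      ofLp_HkE_single hj hc hw ha b₁ b₀.src b₀.dir
    have hdiff : |hKer (P := P) w c j b₀ b₁ - hlKer (P := P) w c R₁ R₀ j b₀ b₁| ≤ |hKer (P := P) w c j b₀ b₁| := by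
      rw [hlKer_apply]
      have h0 := cutoff_nonneg R₁ R₀ (hdist (P := P) j) b₀ b₁
      have h1 := cutoff_le_one R₁ R₀ (hdist (P := P) j) b₀ b₁
      have hfac : hKer (P := P) w c j b₀ b₁ - cutoff R₁ R₀ (hdist (P := P) j) b₀ b₁ * hKer (P := P) w c j b₀ b₁ =
          (1 - cutoff R₁ R₀ (hdist (P := P) j) b₀ b₁) * hKer (P := P) w c j b₀ b₁ := by ring
      rw [hfac, abs_mul, abs_of_nonneg (by linarith)]
      exact mul_le_of_le_one_left (abs_nonneg _) (by linarith)
    refine hdiff.trans ?_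
    rw [e]
    refine (hH _ _ _ _).trans ?_
    rw [mul_assoc, ← Real.exp_add]
    refine mul_le_mul_of_nonneg_left (Real.exp_le_exp.2 ?_) hM
    nlinarith [mul_nonneg hδ (sub_nonneg.2 hfar)]

/-- **the rescaled C-difference**: at the ambient weights `(η_k^d, L^k)` of step `k ≥ j`,
`C^{(j),L^jη}(b₁,b₂) − C^{(j),L^jη}_{loc}(b₁,b₂) = (L^{k−j})^{d−2}·(C^{(j)}(b₁,b₂) − C^{(j)}_{loc}(b₁,b₂))` for p09's matrices of record, hence a bound
`|Cloc − Cmat| ≤ ε·e^{−δ_C|b₁−b₂|}` gives `|cKer − clKer| ≤ (L^{k−j})^{d−2}ε·e^{−δ_C|b₁−b₂|}` ((2.7)-analogue, rescaled). [cite: BalabanImbrieJaffe1988, (2.12) p.261] -/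
theorem abs_cKer_sub_clKer_ambient_le (hd : 2 ≤ P.d) {j k : ℕ} (hjk : j ≤ k) {δC ε : ℝ} {R : ℝ}
    (hCd : ∀ b₁ b₂ : PBond P j, |Cloc P j R b₁ b₂ - Cmat P j b₁ b₂| ≤ ε * Real.exp (-(δC * (supDist b₁.src b₂.src : ℝ))))
    (b₁ b₂ : PBond P j) :
    |cKer (P := P) ((P.eta k) ^ P.d) ((P.L : ℝ) ^ k) j b₁ b₂ - clKer (P := P) ((P.eta k) ^ P.d) ((P.L : ℝ) ^ k) R j b₁ b₂| ≤
      ((P.L : ℝ) ^ (k - j)) ^ (P.d - 2) * ε * Real.exp (-(δC * (supDist b₁.src b₂.src : ℝ))) := by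
  have hℓ : 0 < ((P.L : ℝ) ^ (k - j)) ^ (P.d - 2) := pow_pos (cast_pow_L_pos' _) _
  rw [cKer_ambient_eq hd hjk, clKer_ambient_eq_apply hd hjk, ← mul_sub, abs_mul, abs_of_pos hℓ, ← abs_neg, neg_sub, mul_assoc]
  exact mul_le_mul_of_nonneg_left (hCd b₁ b₂) hℓ.le

/-! ## §2  The difference `𝒟_k − 𝒟_{k,loc}` as a telescoped scale sum, and its bound -/

/-- `𝒟_k(b,b″) − 𝒟_{k,loc}(b,b″) = Σ_{j<k}Σ_{b₁,b₂}[H C H − H_lC_lH_l]` for the (I.4.4.4) propagator of record (p08's `dkKernel_eq_sum`) and r18's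
(2.12), both at the weights `(w, c)`. [cite: BalabanImbrieJaffe1988, (2.12) p.261] -/
theorem dk_sub_dkLoc_eq_sum (w c : ℝ) (ρ : ℕ → ℝ) (k : ℕ) (b b'' : PBond P 0) :
    DkE P w c k (toE P (Pi.single b'' 1)) b - dkLocKer (P := P) w c ρ k b b'' =
      ∑ j ∈ Finset.range k, ∑ b₁ : PBond P j, ∑ b₂ : PBond P j,
        (hKer (P := P) w c j b b₁ * cKer (P := P) w c j b₁ b₂ * hKer (P := P) w c j b'' b₂ -
          hlKer (P := P) w c (ρ j / 16) (ρ j / 8) j b b₁ * clKer (P := P) w c (ρ j / 4) j b₁ b₂ *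
            hlKer (P := P) w c (ρ j / 16) (ρ j / 8) j b'' b₂) := by
  have h1 : DkE P w c k (toE P (Pi.single b'' 1)) b = ∑ j ∈ Finset.range k, ∑ b₁ : PBond P j, ∑ b₂ : PBond P j,
      hKer (P := P) w c j b b₁ * cKer (P := P) w c j b₁ b₂ * hKer (P := P) w c j b'' b₂ :=
    dkKernel_eq_sum w c k b b''
  rw [h1, dkLocKer]
  simp only [← Finset.sum_sub_distrib]

/-- the telescoping `hch′ − h_lc_lh′_l = (h − h_l)ch′ + h_l(c − c_l)h′ + h_lc_l(h′ − h′_l)`. [folklore] -/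
private theorem telescope (h hl c cl h' hl' : ℝ) :
    h * c * h' - hl * cl * hl' = (h - hl) * c * h' + hl * (c - cl) * h' + hl * cl * (h' - hl') := by ring

/-- `L^k = L^j·L^{k−j}` for `j ≤ k`. [folklore] -/
private theorem pow_eq_pow_mul_pow' {j k : ℕ} (hjk : j ≤ k) : (P.L : ℝ) ^ k = (P.L : ℝ) ^ j * (P.L : ℝ) ^ (k - j) := by
  rw [← pow_add, Nat.add_sub_cancel' hjk]

/-- **THE SCALE-`j` DIFFERENCE TERM** (`j ≤ k`, `j ≤ m + K`, every `d ≥ 2`): at the weights `(η_k^d, L^k)` and the radii `r/16 < r/8` (for `ζ_j`),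
`r/4` (for `C̃^{(j)}`), `r > 0`,
`|Σ_{b₁,b₂}[H_jC^{(j),L^jη}H_j − H_{j,loc}C^{(j),L^jη}_{loc}H_{j,loc}](b,b″)| ≤ M²M_C(L^{k−j})^{d−2}·d²e^{a/2}K(a)²·(2e^{−(δ/32)r} + e^{−(δ_C/4)r})·e^{−a|b₋−b″₋|_∞/L^j}`,
`a = min(δ/2, δ_C)/2` — the three telescoped products, each by `abs_triple_le₂`. [cite: BalabanImbrieJaffe1988, (2.13) p.261] -/
theorem abs_diffTerm_le (hd : 2 ≤ P.d) {k j : ℕ} (hj : j ≤ P.m + P.K) (hjk : j ≤ k) {a : ℝ} (ha : 0 < a)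
    {δ M δC MC : ℝ} (hδ : 0 < δ) (hδC : 0 < δC) (hM : 0 ≤ M) (hMC : 0 ≤ MC)
    (hH : ∀ (μ ν : Fin P.d) (x : TSite P 0) (y : TSite P j),
      |(torusRep P j (deltaAData hj a)).H (x, μ) (y, ν)| ≤ M * Real.exp (-(δ * distEU P j x y)))
    {r : ℝ} (hr : 0 < r)
    (hCm : ∀ b₁ b₂ : PBond P j, |Cmat P j b₁ b₂| ≤ MC * Real.exp (-(δC * (supDist b₁.src b₂.src : ℝ))))
    (hCl : ∀ b₁ b₂ : PBond P j, |Cloc P j (r / 4) b₁ b₂| ≤ MC * Real.exp (-(δC * (supDist b₁.src b₂.src : ℝ))))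
    (hCd : ∀ b₁ b₂ : PBond P j, |Cloc P j (r / 4) b₁ b₂ - Cmat P j b₁ b₂| ≤
      MC * Real.exp (-(δC / 4 * r)) * Real.exp (-(δC * (supDist b₁.src b₂.src : ℝ))))
    (b b'' : PBond P 0) :
    |∑ b₁ : PBond P j, ∑ b₂ : PBond P j,
        (hKer (P := P) ((P.eta k) ^ P.d) ((P.L : ℝ) ^ k) j b b₁ * cKer (P := P) ((P.eta k) ^ P.d) ((P.L : ℝ) ^ k) j b₁ b₂ *
            hKer (P := P) ((P.eta k) ^ P.d) ((P.L : ℝ) ^ k) j b'' b₂ -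
          hlKer (P := P) ((P.eta k) ^ P.d) ((P.L : ℝ) ^ k) (r / 16) (r / 8) j b b₁ *
              clKer (P := P) ((P.eta k) ^ P.d) ((P.L : ℝ) ^ k) (r / 4) j b₁ b₂ *
            hlKer (P := P) ((P.eta k) ^ P.d) ((P.L : ℝ) ^ k) (r / 16) (r / 8) j b'' b₂)| ≤
      M ^ 2 * MC * ((P.L : ℝ) ^ (k - j)) ^ (P.d - 2) *
          ((P.d : ℝ) ^ 2 * (Real.exp (min (δ / 2) δC / 2 / 2) * ((2 * (1 + P.d / (min (δ / 2) δC / 2))) ^ P.d) ^ 2)) *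
          (2 * Real.exp (-(δ / 2 * (r / 16))) + Real.exp (-(δC / 4 * r))) *
        Real.exp (-(min (δ / 2) δC / 2 * ((supDist b.src b''.src : ℝ) / (P.L : ℝ) ^ j))) := by
  have hδ2 : 0 < δ / 2 := half_pos hδ
  have hR : r / 16 < r / 8 := by linarith
  have hw : 0 < (P.eta k) ^ P.d := pow_pos (eta_pos P k) _
  have hc : (P.L : ℝ) ^ k ≠ 0 := (cast_pow_L_pos' k).ne'
  set ℓ : ℝ := (P.L : ℝ) ^ (k - j) with hℓ
  have hℓq : 0 < ℓ ^ (P.d - 2) := pow_pos (cast_pow_L_pos' _) _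
  -- the H-side bounds at rate `δ/2`
  have weaken : ∀ (x : TSite P 0) (y : TSite P j),
      M * Real.exp (-(δ * distEU P j x y)) ≤ M * Real.exp (-(δ / 2 * distEU P j x y)) := by
    intro x y
    refine mul_le_mul_of_nonneg_left (Real.exp_le_exp.2 ?_) hM
    have h0 : 0 ≤ distEU P j x y := div_nonneg (Nat.cast_nonneg _) (cast_pow_L_pos' j).le
    nlinarith
  have hh : ∀ (b₀ : PBond P 0) (b₁ : PBond P j),
      |hKer (P := P) ((P.eta k) ^ P.d) ((P.L : ℝ) ^ k) j b₀ b₁| ≤ M * Real.exp (-(δ / 2 * distEU P j b₀.src b₁.src)) := by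
    intro b₀ b₁
    have e : hKer (P := P) ((P.eta k) ^ P.d) ((P.L : ℝ) ^ k) j b₀ b₁ =
        (torusRep P j (deltaAData hj a)).H (b₀.src, b₀.dir) (b₁.src, b₁.dir) := ofLp_HkE_single hj hc hw ha b₁ b₀.src b₀.dir
    rw [e]
    exact (hH _ _ _ _).trans (weaken _ _)
  have hhl : ∀ (b₀ : PBond P 0) (b₁ : PBond P j),
      |hlKer (P := P) ((P.eta k) ^ P.d) ((P.L : ℝ) ^ k) (r / 16) (r / 8) j b₀ b₁| ≤
        M * Real.exp (-(δ / 2 * distEU P j b₀.src b₁.src)) :=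
    fun b₀ b₁ => (abs_hlKer_le_of_sup hj hw hc ha hH (r / 16) (r / 8) b₀ b₁).trans (weaken _ _)
  have hhd : ∀ (b₀ : PBond P 0) (b₁ : PBond P j),
      |hKer (P := P) ((P.eta k) ^ P.d) ((P.L : ℝ) ^ k) j b₀ b₁ -
          hlKer (P := P) ((P.eta k) ^ P.d) ((P.L : ℝ) ^ k) (r / 16) (r / 8) j b₀ b₁| ≤
        M * Real.exp (-(δ / 2 * (r / 16))) * Real.exp (-(δ / 2 * distEU P j b₀.src b₁.src)) :=
    fun b₀ b₁ => abs_hKer_sub_hlKer_le hj hw hc ha hδ.le hH hR b₀ b₁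
  -- the C-side bounds at the ambient weights
  have hc1 : ∀ b₁ b₂ : PBond P j, |cKer (P := P) ((P.eta k) ^ P.d) ((P.L : ℝ) ^ k) j b₁ b₂| ≤
      MC * ℓ ^ (P.d - 2) * Real.exp (-(δC * (supDist b₁.src b₂.src : ℝ))) := by
    intro b₁ b₂
    rw [cKer_ambient_eq hd hjk, abs_mul, abs_of_pos hℓq]
    calc ℓ ^ (P.d - 2) * |Cmat P j b₁ b₂| ≤ ℓ ^ (P.d - 2) * (MC * Real.exp (-(δC * (supDist b₁.src b₂.src : ℝ)))) :=
        mul_le_mul_of_nonneg_left (hCm b₁ b₂) hℓq.le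
      _ = _ := by ring
  have hc2 : ∀ b₁ b₂ : PBond P j, |clKer (P := P) ((P.eta k) ^ P.d) ((P.L : ℝ) ^ k) (r / 4) j b₁ b₂| ≤
      MC * ℓ ^ (P.d - 2) * Real.exp (-(δC * (supDist b₁.src b₂.src : ℝ))) := by
    intro b₁ b₂
    rw [clKer_ambient_eq_apply hd hjk, abs_mul, abs_of_pos hℓq]
    calc ℓ ^ (P.d - 2) * |Cloc P j (r / 4) b₁ b₂| ≤ ℓ ^ (P.d - 2) * (MC * Real.exp (-(δC * (supDist b₁.src b₂.src : ℝ)))) :=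
        mul_le_mul_of_nonneg_left (hCl b₁ b₂) hℓq.le
      _ = _ := by ring
  have hc3 : ∀ b₁ b₂ : PBond P j, |cKer (P := P) ((P.eta k) ^ P.d) ((P.L : ℝ) ^ k) j b₁ b₂ -
      clKer (P := P) ((P.eta k) ^ P.d) ((P.L : ℝ) ^ k) (r / 4) j b₁ b₂| ≤
      (ℓ ^ (P.d - 2) * MC * Real.exp (-(δC / 4 * r))) * Real.exp (-(δC * (supDist b₁.src b₂.src : ℝ))) := by
    intro b₁ b₂
    have h := abs_cKer_sub_clKer_ambient_le hd hjk (δC := δC) (ε := MC * Real.exp (-(δC / 4 * r))) (R := r / 4)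
      (fun b₁ b₂ => (hCd b₁ b₂).trans (le_of_eq (by ring))) b₁ b₂
    refine h.trans (le_of_eq ?_)
    rw [hℓ]; ring
  -- the three telescoped products
  have hM' : 0 ≤ M * Real.exp (-(δ / 2 * (r / 16))) := by positivity
  have hMC1 : 0 ≤ MC * ℓ ^ (P.d - 2) := by positivity
  have hMC3 : 0 ≤ ℓ ^ (P.d - 2) * MC * Real.exp (-(δC / 4 * r)) := by positivity
  have t1 := abs_triple_le₂ hj hδ2 hδC hM' hM hMC1 hhd hh hc1 b b''
  have t2 := abs_triple_le₂ hj hδ2 hδC hM hM hMC3 hhl hh hc3 b b''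
  have t3 := abs_triple_le₂ hj hδ2 hδC hM hM' hMC1 hhl hhd hc2 b b''
  -- split the scale term into the three products
  have hsplit : (∑ b₁ : PBond P j, ∑ b₂ : PBond P j,
        (hKer (P := P) ((P.eta k) ^ P.d) ((P.L : ℝ) ^ k) j b b₁ * cKer (P := P) ((P.eta k) ^ P.d) ((P.L : ℝ) ^ k) j b₁ b₂ *
            hKer (P := P) ((P.eta k) ^ P.d) ((P.L : ℝ) ^ k) j b'' b₂ -
          hlKer (P := P) ((P.eta k) ^ P.d) ((P.L : ℝ) ^ k) (r / 16) (r / 8) j b b₁ *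
              clKer (P := P) ((P.eta k) ^ P.d) ((P.L : ℝ) ^ k) (r / 4) j b₁ b₂ *
            hlKer (P := P) ((P.eta k) ^ P.d) ((P.L : ℝ) ^ k) (r / 16) (r / 8) j b'' b₂)) =
      (∑ b₁ : PBond P j, ∑ b₂ : PBond P j,
        (hKer (P := P) ((P.eta k) ^ P.d) ((P.L : ℝ) ^ k) j b b₁ -
            hlKer (P := P) ((P.eta k) ^ P.d) ((P.L : ℝ) ^ k) (r / 16) (r / 8) j b b₁) *
          cKer (P := P) ((P.eta k) ^ P.d) ((P.L : ℝ) ^ k) j b₁ b₂ * hKer (P := P) ((P.eta k) ^ P.d) ((P.L : ℝ) ^ k) j b'' b₂) +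
      (∑ b₁ : PBond P j, ∑ b₂ : PBond P j,
        hlKer (P := P) ((P.eta k) ^ P.d) ((P.L : ℝ) ^ k) (r / 16) (r / 8) j b b₁ *
          (cKer (P := P) ((P.eta k) ^ P.d) ((P.L : ℝ) ^ k) j b₁ b₂ -
            clKer (P := P) ((P.eta k) ^ P.d) ((P.L : ℝ) ^ k) (r / 4) j b₁ b₂) *
          hKer (P := P) ((P.eta k) ^ P.d) ((P.L : ℝ) ^ k) j b'' b₂) +
      (∑ b₁ : PBond P j, ∑ b₂ : PBond P j,
        hlKer (P := P) ((P.eta k) ^ P.d) ((P.L : ℝ) ^ k) (r / 16) (r / 8) j b b₁ *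
          clKer (P := P) ((P.eta k) ^ P.d) ((P.L : ℝ) ^ k) (r / 4) j b₁ b₂ *
          (hKer (P := P) ((P.eta k) ^ P.d) ((P.L : ℝ) ^ k) j b'' b₂ -
            hlKer (P := P) ((P.eta k) ^ P.d) ((P.L : ℝ) ^ k) (r / 16) (r / 8) j b'' b₂)) := by
    rw [← Finset.sum_add_distrib, ← Finset.sum_add_distrib]
    refine Finset.sum_congr rfl fun b₁ _ => ?_
    rw [← Finset.sum_add_distrib, ← Finset.sum_add_distrib]
    refine Finset.sum_congr rfl fun b₂ _ => ?_
    exact telescope _ _ _ _ _ _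
  rw [hsplit]
  refine (abs_add_three _ _ _).trans ?_
  refine (add_le_add (add_le_add t1 t2) t3).trans (le_of_eq ?_)
  rw [hℓ]
  ring

/-- **THE KERNEL CLOSENESS `|𝒟_k(b,b″) − 𝒟_{k,loc}(b,b″)| ≤ c₀e^{−cρ_k}e^{−(a/2)dist_k(b,b″)}` FOR `dist_k ≥ 2`, explicit constants, every `d ≥ 2`**
(`a = min(δ/2, δ_C)/2`, `c = min(δ/32, δ_C/4)`): GIVEN the sup member of (I.7.2.2) for every `H_j`, `j < k` (`M, δ`), bounds `M_Ce^{−δ_C|·|}` for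
p09's `C^{(j)}` and `C^{(j)}_{loc}` of record and `M_Ce^{−(δ_C/4)ρ_j}e^{−δ_C|·|}` for their difference at the radii `ρ_j/4`, and a schedule with
`0 < ρ_j`, `ρ_k ≤ ρ_j` for `j < k`: the scale terms of `abs_diffTerm_le` carry `2e^{−(δ/32)ρ_j} + e^{−(δ_C/4)ρ_j} ≤ 3e^{−cρ_k}`, and p08's
multiscale step sums `(L^{k−j})^{d−2}e^{−aL^{k−j}D}`. [cite: BalabanImbrieJaffe1988, (2.13) p.261] -/
theorem abs_dk_sub_dkLoc_le (hd : 2 ≤ P.d) {k : ℕ} (hk : k ≤ P.m + P.K) {a : ℝ} (ha : 0 < a) {δ M δC MC : ℝ} (hδ : 0 < δ)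
    (hδC : 0 < δC) (hM : 0 ≤ M) (hMC : 0 ≤ MC)
    (hH : ∀ (j : ℕ) (hj : j ≤ P.m + P.K), j < k → ∀ (μ ν : Fin P.d) (x : TSite P 0) (y : TSite P j),
      |(torusRep P j (deltaAData hj a)).H (x, μ) (y, ν)| ≤ M * Real.exp (-(δ * distEU P j x y)))
    (ρ : ℕ → ℝ) (hρ : ∀ j < k, 0 < ρ j) (hmono : ∀ j < k, ρ k ≤ ρ j)
    (hCm : ∀ j < k, ∀ b₁ b₂ : PBond P j, |Cmat P j b₁ b₂| ≤ MC * Real.exp (-(δC * (supDist b₁.src b₂.src : ℝ))))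
    (hCl : ∀ j < k, ∀ b₁ b₂ : PBond P j, |Cloc P j (ρ j / 4) b₁ b₂| ≤ MC * Real.exp (-(δC * (supDist b₁.src b₂.src : ℝ))))
    (hCd : ∀ j < k, ∀ b₁ b₂ : PBond P j, |Cloc P j (ρ j / 4) b₁ b₂ - Cmat P j b₁ b₂| ≤
      MC * Real.exp (-(δC / 4 * ρ j)) * Real.exp (-(δC * (supDist b₁.src b₂.src : ℝ))))
    {b b'' : PBond P 0} (hD : 2 ≤ kdist (P := P) k b b'') :
    |DkE P ((P.eta k) ^ P.d) ((P.L : ℝ) ^ k) k (toE P (Pi.single b'' 1)) b -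
        dkLocKer (P := P) ((P.eta k) ^ P.d) ((P.L : ℝ) ^ k) ρ k b b''| ≤
      3 * M ^ 2 * MC * ((P.d : ℝ) ^ 2 * (Real.exp (min (δ / 2) δC / 2 / 2) * ((2 * (1 + P.d / (min (δ / 2) δC / 2))) ^ P.d) ^ 2)) *
          Real.exp (-(min (δ / 32) (δC / 4) * ρ k)) *
          ((((P.d - 2 + 1).factorial : ℝ)) / (min (δ / 2) δC / 2) ^ (P.d - 2 + 1)) *
        Real.exp (-(min (δ / 2) δC / 2 / 2 * kdist (P := P) k b b'')) := by
  have hδ2 : 0 < δ / 2 := half_pos hδ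
  have ha₀ : 0 < min (δ / 2) δC / 2 := half_pos (lt_min hδ2 hδC)
  have hcc0 : 0 ≤ min (δ / 32) (δC / 4) := le_min (by positivity) (by positivity)
  have hcc1 : min (δ / 32) (δC / 4) ≤ δ / 32 := min_le_left _ _
  have hcc2 : min (δ / 32) (δC / 4) ≤ δC / 4 := min_le_right _ _
  rw [dk_sub_dkLoc_eq_sum]
  refine abs_sum_scales_le (P := P) (k := k)
    (T := fun j => ∑ b₁ : PBond P j, ∑ b₂ : PBond P j,
        (hKer (P := P) ((P.eta k) ^ P.d) ((P.L : ℝ) ^ k) j b b₁ * cKer (P := P) ((P.eta k) ^ P.d) ((P.L : ℝ) ^ k) j b₁ b₂ *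
            hKer (P := P) ((P.eta k) ^ P.d) ((P.L : ℝ) ^ k) j b'' b₂ -
          hlKer (P := P) ((P.eta k) ^ P.d) ((P.L : ℝ) ^ k) (ρ j / 16) (ρ j / 8) j b b₁ *
              clKer (P := P) ((P.eta k) ^ P.d) ((P.L : ℝ) ^ k) (ρ j / 4) j b₁ b₂ *
            hlKer (P := P) ((P.eta k) ^ P.d) ((P.L : ℝ) ^ k) (ρ j / 16) (ρ j / 8) j b'' b₂))
    (A := 3 * M ^ 2 * MC * ((P.d : ℝ) ^ 2 * (Real.exp (min (δ / 2) δC / 2 / 2) *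
        ((2 * (1 + P.d / (min (δ / 2) δC / 2))) ^ P.d) ^ 2)) * Real.exp (-(min (δ / 32) (δC / 4) * ρ k)))
    (a := min (δ / 2) δC / 2) (D := kdist (P := P) k b b'') (by positivity) ha₀ hD (P.d - 2) fun j hjk => ?_
  have hj : j ≤ P.m + P.K := by omega
  have hρj : 0 < ρ j := hρ j hjk
  have hρkj : ρ k ≤ ρ j := hmono j hjk
  have hterm := abs_diffTerm_le hd hj hjk.le ha hδ hδC hM hMC (hH j hj hjk) hρj (hCm j hjk) (hCl j hjk) (hCd j hjk) b b''
  -- `supDist/L^j = L^{k−j}·dist_k`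
  have e1 : (supDist b.src b''.src : ℝ) / (P.L : ℝ) ^ j = (P.L : ℝ) ^ (k - j) * kdist (P := P) k b b'' := by
    unfold kdist
    rw [pow_eq_pow_mul_pow' (P := P) hjk.le]
    have hLj := cast_pow_L_pos' (P := P) j
    have hLkj := cast_pow_L_pos' (P := P) (k - j)
    field_simp
  rw [e1] at hterm
  -- the smallness factors are at most `e^{−cρ_k}`
  have hs1 : Real.exp (-(δ / 2 * (ρ j / 16))) ≤ Real.exp (-(min (δ / 32) (δC / 4) * ρ k)) := by
    refine Real.exp_le_exp.2 ?_
    nlinarith [mul_le_mul_of_nonneg_right hcc1 hρj.le, mul_le_mul_of_nonneg_left hρkj hcc0]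
  have hs2 : Real.exp (-(δC / 4 * ρ j)) ≤ Real.exp (-(min (δ / 32) (δC / 4) * ρ k)) := by
    refine Real.exp_le_exp.2 ?_
    nlinarith [mul_le_mul_of_nonneg_right hcc2 hρj.le, mul_le_mul_of_nonneg_left hρkj hcc0]
  have hs : 2 * Real.exp (-(δ / 2 * (ρ j / 16))) + Real.exp (-(δC / 4 * ρ j)) ≤
      3 * Real.exp (-(min (δ / 32) (δC / 4) * ρ k)) := by linarith
  refine hterm.trans ?_
  have hW : 0 ≤ M ^ 2 * MC * ((P.L : ℝ) ^ (k - j)) ^ (P.d - 2) *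
      ((P.d : ℝ) ^ 2 * (Real.exp (min (δ / 2) δC / 2 / 2) * ((2 * (1 + P.d / (min (δ / 2) δC / 2))) ^ P.d) ^ 2)) *
      Real.exp (-(min (δ / 2) δC / 2 * ((P.L : ℝ) ^ (k - j) * kdist (P := P) k b b''))) := by positivity
  calc M ^ 2 * MC * ((P.L : ℝ) ^ (k - j)) ^ (P.d - 2) *
          ((P.d : ℝ) ^ 2 * (Real.exp (min (δ / 2) δC / 2 / 2) * ((2 * (1 + P.d / (min (δ / 2) δC / 2))) ^ P.d) ^ 2)) *
          (2 * Real.exp (-(δ / 2 * (ρ j / 16))) + Real.exp (-(δC / 4 * ρ j))) *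
        Real.exp (-(min (δ / 2) δC / 2 * ((P.L : ℝ) ^ (k - j) * kdist (P := P) k b b'')))
      = (M ^ 2 * MC * ((P.L : ℝ) ^ (k - j)) ^ (P.d - 2) *
          ((P.d : ℝ) ^ 2 * (Real.exp (min (δ / 2) δC / 2 / 2) * ((2 * (1 + P.d / (min (δ / 2) δC / 2))) ^ P.d) ^ 2)) *
          Real.exp (-(min (δ / 2) δC / 2 * ((P.L : ℝ) ^ (k - j) * kdist (P := P) k b b'')))) *
          (2 * Real.exp (-(δ / 2 * (ρ j / 16))) + Real.exp (-(δC / 4 * ρ j))) := by ring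
    _ ≤ (M ^ 2 * MC * ((P.L : ℝ) ^ (k - j)) ^ (P.d - 2) *
          ((P.d : ℝ) ^ 2 * (Real.exp (min (δ / 2) δC / 2 / 2) * ((2 * (1 + P.d / (min (δ / 2) δC / 2))) ^ P.d) ^ 2)) *
          Real.exp (-(min (δ / 2) δC / 2 * ((P.L : ℝ) ^ (k - j) * kdist (P := P) k b b'')))) *
          (3 * Real.exp (-(min (δ / 32) (δC / 4) * ρ k))) := mul_le_mul_of_nonneg_left hs hW
    _ = _ := by ring

/-! ## §3  Assembly per tower: from the typed (I.7.2.2), and with NO hypothesis -/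

/-- `Me^{−δt} ≤ M′e^{−(δ/2)t}` for `0 ≤ M ≤ M′`, `δ, t ≥ 0`. [folklore] -/
private theorem weaken_exp {M M' δ t : ℝ} (hM : 0 ≤ M) (hMM : M ≤ M') (hδ : 0 ≤ δ) (ht : 0 ≤ t) :
    M * Real.exp (-(δ * t)) ≤ M' * Real.exp (-(δ / 2 * t)) :=
  mul_le_mul hMM (Real.exp_le_exp.2 (by nlinarith)) (Real.exp_pos _).le (hM.trans hMM)

/-- the C-side inputs of `abs_dk_sub_dkLoc_le` from p09's (2.5)–(2.7)-analogues `cloc_estimates` (constants `(M_C, δ₀)` from `(d, L)`):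
with `M_C′ = M_Ce^{4δ₀L}(1+L)²` and the rate `δ₀/2`, the three bounds hold at every scale `j + 1 ≤ m + K` and every radius `r`.
[cite: BalabanImbrieJaffe1988, (2.9) p.261] -/
theorem cSide_of_cloc_estimates {MC δ₀ : ℝ} (hMC : 0 < MC) (hδ₀ : 0 < δ₀) {j : ℕ} [DecidableEq (PBond P j)]
    (HC : ∀ (R : ℝ) (b b' : PBond P j),
      |Cmat P j b b'| ≤ MC * Real.exp (-(δ₀ * distB P j b b')) ∧
      |Cloc P j R b b'| ≤ MC * Real.exp (4 * δ₀ * P.L) * (1 + P.L) ^ 2 * Real.exp (-(δ₀ * distB P j b b')) ∧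
      (R + 4 * P.L < distB P j b b' → Cloc P j R b b' = 0) ∧
      |Cloc P j R b b' - Cmat P j b b'| ≤
        MC * Real.exp (2 * δ₀ * P.L) * (1 + P.L) ^ 2 * Real.exp (-(δ₀ / 2 * R)) * Real.exp (-(δ₀ / 2 * distB P j b b')))
    (r : ℝ) :
    (∀ b₁ b₂ : PBond P j, |Cmat P j b₁ b₂| ≤
        MC * (Real.exp (4 * δ₀ * P.L) * (1 + P.L) ^ 2) * Real.exp (-(δ₀ / 2 * (supDist b₁.src b₂.src : ℝ)))) ∧
    (∀ b₁ b₂ : PBond P j, |Cloc P j (r / 4) b₁ b₂| ≤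
        MC * (Real.exp (4 * δ₀ * P.L) * (1 + P.L) ^ 2) * Real.exp (-(δ₀ / 2 * (supDist b₁.src b₂.src : ℝ)))) ∧
    (∀ b₁ b₂ : PBond P j, |Cloc P j (r / 4) b₁ b₂ - Cmat P j b₁ b₂| ≤
        MC * (Real.exp (4 * δ₀ * P.L) * (1 + P.L) ^ 2) * Real.exp (-(δ₀ / 2 / 4 * r)) *
          Real.exp (-(δ₀ / 2 * (supDist b₁.src b₂.src : ℝ)))) := by
  have hL0 : (0 : ℝ) ≤ P.L := Nat.cast_nonneg _
  have h1 : (1 : ℝ) ≤ Real.exp (4 * δ₀ * P.L) := Real.one_le_exp (by positivity)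
  have h2 : (1 : ℝ) ≤ (1 + (P.L : ℝ)) ^ 2 := one_le_pow₀ (by linarith)
  have h12 : (1 : ℝ) ≤ Real.exp (4 * δ₀ * P.L) * (1 + P.L) ^ 2 := one_le_mul_of_one_le_of_one_le h1 h2
  have hMC' : MC ≤ MC * (Real.exp (4 * δ₀ * P.L) * (1 + P.L) ^ 2) := le_mul_of_one_le_right hMC.le h12
  have hexp24 : Real.exp (2 * δ₀ * P.L) ≤ Real.exp (4 * δ₀ * P.L) := Real.exp_le_exp.2 (by nlinarith)
  refine ⟨fun b₁ b₂ => ?_, fun b₁ b₂ => ?_, fun b₁ b₂ => ?_⟩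
  · have h := (HC (r / 4) b₁ b₂).1
    rw [distB_apply] at h
    exact h.trans (weaken_exp hMC.le hMC' hδ₀.le (Nat.cast_nonneg _))
  · have h := (HC (r / 4) b₁ b₂).2.1
    rw [distB_apply] at h
    have h' : |Cloc P j (r / 4) b₁ b₂| ≤ MC * (Real.exp (4 * δ₀ * P.L) * (1 + P.L) ^ 2) *
        Real.exp (-(δ₀ * (supDist b₁.src b₂.src : ℝ))) := h.trans (le_of_eq (by ring))
    exact h'.trans (weaken_exp (by positivity) le_rfl hδ₀.le (Nat.cast_nonneg _))
  · have h := (HC (r / 4) b₁ b₂).2.2.2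
    rw [distB_apply] at h
    refine h.trans ?_
    have hA : MC * Real.exp (2 * δ₀ * P.L) * (1 + P.L) ^ 2 ≤ MC * (Real.exp (4 * δ₀ * P.L) * (1 + P.L) ^ 2) := by
      rw [← mul_assoc]
      exact mul_le_mul_of_nonneg_right (mul_le_mul_of_nonneg_left hexp24 hMC.le) (by positivity)
    have hr : Real.exp (-(δ₀ / 2 * (r / 4))) = Real.exp (-(δ₀ / 2 / 4 * r)) := by ring_nf
    rw [hr]
    exact mul_le_mul_of_nonneg_right (mul_le_mul_of_nonneg_right hA (Real.exp_pos _).le) (Real.exp_pos _).le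

/-- **`𝒟_{k,loc}` IS CLOSE TO `𝒟_k` ON THE TORI, FROM THE TYPED (I.7.2.2) ALONE** (C-side HYPOTHESIS-FREE by p09's `cloc_estimates`): given r15's
`KernelData.Ineq722` for p09's kernel family (scales covering the standing range), there are `R₀, c₀ ≥ 0, c > 0, δ′ > 0` with
`|𝒟_k(b,b″) − 𝒟_{k,loc}(b,b″)| ≤ c₀e^{−cρ_k}e^{−δ′dist_k(b,b″)}` for every `k ≤ m + K`, every schedule `ρ` with `0 < ρ_j`, `ρ_k ≤ ρ_j` (`j < k`),
and all `b, b″` with `dist_k(b,b″) ≥ R₀`. [cite: BalabanImbrieJaffe1988, (2.13) p.261] -/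
theorem close_dkLoc_dk_torus_of_ineq722 (hd : 2 ≤ P.d) {lev : ℕ → ℕ} (hlev : ∀ i, lev i ≤ P.m + P.K)
    (hcov : ∀ j ≤ P.m + P.K, ∃ i, lev i = j) {a : ℝ} {BondU : ℕ → Type}
    {distEB : (i : ℕ) → TSite P 0 → BondU i → ℝ} {Cker : (i : ℕ) → Fin P.d → Fin P.d → TSite P (lev i) → TSite P (lev i) → ℝ}
    {Dker : (i : ℕ) → TSite P 0 → BondU i → ℝ}
    (h722 : KernelData.Ineq722
      (fun i => torusKernelData P (lev i) (deltaAData (hlev i) a) (BondU i) (distEB i) (Cker i) (Dker i))) (ha : 0 < a) :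
    ∃ R₀ c₀ c δ' : ℝ, 0 < c ∧ 0 < δ' ∧ 0 ≤ c₀ ∧ ∀ (k : ℕ) (_ : k ≤ P.m + P.K) (ρ : ℕ → ℝ),
      (∀ j < k, 0 < ρ j) → (∀ j < k, ρ k ≤ ρ j) → ∀ (b b'' : PBond P 0), R₀ ≤ kdist (P := P) k b b'' →
        |DkE P ((P.eta k) ^ P.d) ((P.L : ℝ) ^ k) k (toE P (Pi.single b'' 1)) b -
            dkLocKer (P := P) ((P.eta k) ^ P.d) ((P.L : ℝ) ^ k) ρ k b b''| ≤
          c₀ * Real.exp (-(c * ρ k)) * Real.exp (-δ' * kdist (P := P) k b b'') := by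
  classical
  obtain ⟨δ, M, hδ, hM, hBall⟩ := exists_bound_of_ineq722 hlev h722
  obtain ⟨MC, δ₀, hMC, hδ₀, HC⟩ := cloc_estimates P.d P.L hd
  have hδC : 0 < δ₀ / 2 := half_pos hδ₀
  refine ⟨2, 3 * M ^ 2 * (MC * (Real.exp (4 * δ₀ * P.L) * (1 + P.L) ^ 2)) *
      ((P.d : ℝ) ^ 2 * (Real.exp (min (δ / 2) (δ₀ / 2) / 2 / 2) * ((2 * (1 + P.d / (min (δ / 2) (δ₀ / 2) / 2))) ^ P.d) ^ 2)) *
      ((((P.d - 2 + 1).factorial : ℝ)) / (min (δ / 2) (δ₀ / 2) / 2) ^ (P.d - 2 + 1)),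
    min (δ / 32) (δ₀ / 2 / 4), min (δ / 2) (δ₀ / 2) / 2 / 2, ?_, ?_, by positivity, fun k hk ρ hρ hmono b b'' hfar => ?_⟩
  · exact lt_min (by positivity) (by positivity)
  · have := lt_min (half_pos hδ) hδC; positivity
  have hH : ∀ (j : ℕ) (hj : j ≤ P.m + P.K), j < k → ∀ (μ ν : Fin P.d) (x : TSite P 0) (y : TSite P j),
      |(torusRep P j (deltaAData hj a)).H (x, μ) (y, ν)| ≤ M * Real.exp (-(δ * distEU P j x y)) := by
    intro j hj _ μ ν x y
    obtain ⟨i, hi⟩ := hcov j hj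
    subst hi
    exact (le_add_of_nonneg_right torusKernelData_gradH_nonneg).trans (hBall i μ ν x y)
  have hC : ∀ j < k, (∀ b₁ b₂ : PBond P j, |Cmat P j b₁ b₂| ≤
        MC * (Real.exp (4 * δ₀ * P.L) * (1 + P.L) ^ 2) * Real.exp (-(δ₀ / 2 * (supDist b₁.src b₂.src : ℝ)))) ∧
      (∀ b₁ b₂ : PBond P j, |Cloc P j (ρ j / 4) b₁ b₂| ≤
        MC * (Real.exp (4 * δ₀ * P.L) * (1 + P.L) ^ 2) * Real.exp (-(δ₀ / 2 * (supDist b₁.src b₂.src : ℝ)))) ∧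
      (∀ b₁ b₂ : PBond P j, |Cloc P j (ρ j / 4) b₁ b₂ - Cmat P j b₁ b₂| ≤
        MC * (Real.exp (4 * δ₀ * P.L) * (1 + P.L) ^ 2) * Real.exp (-(δ₀ / 2 / 4 * ρ j)) *
          Real.exp (-(δ₀ / 2 * (supDist b₁.src b₂.src : ℝ)))) :=
    fun j hjk => cSide_of_cloc_estimates hMC hδ₀ (fun R b b' => HC P rfl rfl j inferInstance (by omega) R b b') (ρ j)
  rw [neg_mul]
  exact (abs_dk_sub_dkLoc_le hd hk ha hδ hδC hM (by positivity) hH ρ hρ hmono (fun j hjk => (hC j hjk).1)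
    (fun j hjk => (hC j hjk).2.1) (fun j hjk => (hC j hjk).2.2) hfar).trans (le_of_eq (by ring))

/-- **`𝒟_{k,loc}` IS CLOSE TO `𝒟_k` ON THE TORUS — NO HYPOTHESIS AT ALL** (every torus of the series with `d ≥ 2`): the per-tower
[6I] Prop. 1.2 input of the previous theorem is finite bookkeeping (p16's `prop12Printed_levStd_deltaA`, typing note G-C1-07), the C-side is
p09's hypothesis-free `cloc_estimates`: `∃ R₀ c₀ c δ′`, `0 < c`, `0 < δ′`, `0 ≤ c₀`, such that for every `k ≤ m + K`, every radius schedule with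
`0 < ρ_j` and `ρ_k ≤ ρ_j` (`j < k`), and all `η`-bonds with `dist_k(b,b″) ≥ R₀`:
`|𝒟_k(b,b″) − 𝒟_{k,loc}(b,b″)| ≤ c₀·e^{−cρ_k}·e^{−δ′dist_k(b,b″)}` — the p. 261 clause *"𝒟_{k,loc} is close to 𝒟_k"* in kernel form, smallness
`e^{−cr(e_k)}` at the printed schedule. [cite: BalabanImbrieJaffe1988, (2.13) p.261] -/
theorem close_dkLoc_dk_torus (hd : 2 ≤ P.d) :
    ∃ R₀ c₀ c δ' : ℝ, 0 < c ∧ 0 < δ' ∧ 0 ≤ c₀ ∧ ∀ (k : ℕ) (_ : k ≤ P.m + P.K) (ρ : ℕ → ℝ),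
      (∀ j < k, 0 < ρ j) → (∀ j < k, ρ k ≤ ρ j) → ∀ (b b'' : PBond P 0), R₀ ≤ kdist (P := P) k b b'' →
        |DkE P ((P.eta k) ^ P.d) ((P.L : ℝ) ^ k) k (toE P (Pi.single b'' 1)) b -
            dkLocKer (P := P) ((P.eta k) ^ P.d) ((P.L : ℝ) ^ k) ρ k b b''| ≤
          c₀ * Real.exp (-(c * ρ k)) * Real.exp (-δ' * kdist (P := P) k b b'') :=
  close_dkLoc_dk_torus_of_ineq722 hd levStd_le (fun j hj => ⟨j, min_eq_left hj⟩)
    (ineq722_deltaA_of_prop12Printed (levStd P) levStd_le one_pos (fun _ => PUnit) (fun _ _ _ => 0) (fun _ _ _ _ _ => 0)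
      (fun _ _ _ => 0) (prop12Printed_levStd_deltaA P 1)) one_pos

/-! ## §4  Over all tori: one set of constants for every torus and every scale -/

/-- **`𝒟_{k,loc}` IS CLOSE TO `𝒟_k` OVER ALL TORI FROM [6I] PROP. 1.2 BY ITS TREE NAME** (the faithful uniformity, typing note G-C1-07): if
`B5.Prop12Printed` holds over the all-tori index of dimension `d ≥ 2` and block size `L`, there is ONE `(R₀, c₀, c, δ′)` such that for EVERY torus
`P` (`P.d = d`, `P.L = L`), every `k ≤ m + K`, every schedule with `0 < ρ_j`, `ρ_k ≤ ρ_j` (`j < k`) and all `b, b″` with `dist_k(b,b″) ≥ R₀`: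
`|𝒟_k(b,b″) − 𝒟_{k,loc}(b,b″)| ≤ c₀e^{−cρ_k}e^{−δ′dist_k(b,b″)}` (p16's all-tori `|H|` member + `H_0 = I`, p09's all-tori `cloc_estimates`).
[cite: BalabanImbrieJaffe1988, (2.13) p.261] -/
theorem close_dkLoc_dk_allTori_of_prop12Printed {d L : ℕ} (hd : 2 ≤ d) (hL : Odd L ∧ 1 < L) {a : ℝ} (ha : 0 < a)
    (h12 : B5.Prop12Printed (fun i : {x : Params × ℕ // x.1.d = d ∧ x.1.L = L ∧ 1 ≤ x.2 ∧ x.2 ≤ x.1.m + x.1.K} =>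
      settingOf (torusRep i.1.1 i.1.2 (deltaAData i.2.2.2.2 a)) i.1.2)) :
    ∃ R₀ c₀ c δ' : ℝ, 0 < c ∧ 0 < δ' ∧ 0 ≤ c₀ ∧ ∀ (P : Params) (_ : P.d = d) (_ : P.L = L) (k : ℕ) (_ : k ≤ P.m + P.K)
      (ρ : ℕ → ℝ), (∀ j < k, 0 < ρ j) → (∀ j < k, ρ k ≤ ρ j) → ∀ (b b'' : PBond P 0), R₀ ≤ kdist (P := P) k b b'' →
        |DkE P ((P.eta k) ^ P.d) ((P.L : ℝ) ^ k) k (toE P (Pi.single b'' 1)) b -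
            dkLocKer (P := P) ((P.eta k) ^ P.d) ((P.L : ℝ) ^ k) ρ k b b''| ≤
          c₀ * Real.exp (-(c * ρ k)) * Real.exp (-δ' * kdist (P := P) k b b'') := by
  classical
  obtain ⟨δ, M, hδ, hM1, hHall⟩ := exists_absH_le_allTori_of_prop12Printed (le_trans one_le_two hd) hL ha h12
  obtain ⟨MC, δ₀, hMC, hδ₀, HC⟩ := cloc_estimates d L hd
  have hδC : 0 < δ₀ / 2 := half_pos hδ₀
  have hM : 0 ≤ M := zero_le_one.trans hM1
  refine ⟨2, 3 * M ^ 2 * (MC * (Real.exp (4 * δ₀ * L) * (1 + L) ^ 2)) *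
      ((d : ℝ) ^ 2 * (Real.exp (min (δ / 2) (δ₀ / 2) / 2 / 2) * ((2 * (1 + d / (min (δ / 2) (δ₀ / 2) / 2))) ^ d) ^ 2)) *
      ((((d - 2 + 1).factorial : ℝ)) / (min (δ / 2) (δ₀ / 2) / 2) ^ (d - 2 + 1)),
    min (δ / 32) (δ₀ / 2 / 4), min (δ / 2) (δ₀ / 2) / 2 / 2, ?_, ?_, by positivity,
    fun P hPd hPL k hk ρ hρ hmono b b'' hfar => ?_⟩
  · exact lt_min (by positivity) (by positivity)
  · have := lt_min (half_pos hδ) hδC; positivity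
  subst hPd; subst hPL
  have hH : ∀ (j : ℕ) (hj : j ≤ P.m + P.K), j < k → ∀ (μ ν : Fin P.d) (x : TSite P 0) (y : TSite P j),
      |(torusRep P j (deltaAData hj a)).H (x, μ) (y, ν)| ≤ M * Real.exp (-(δ * distEU P j x y)) := by
    intro j hj _ μ ν x y
    rcases Nat.eq_zero_or_pos j with hj0 | hj1
    · subst hj0
      exact abs_H_zero_le hj ha hM1 δ μ ν x y
    · exact hHall P rfl rfl j hj1 hj μ ν x y
  have hC : ∀ j < k, (∀ b₁ b₂ : PBond P j, |Cmat P j b₁ b₂| ≤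
        MC * (Real.exp (4 * δ₀ * P.L) * (1 + P.L) ^ 2) * Real.exp (-(δ₀ / 2 * (supDist b₁.src b₂.src : ℝ)))) ∧
      (∀ b₁ b₂ : PBond P j, |Cloc P j (ρ j / 4) b₁ b₂| ≤
        MC * (Real.exp (4 * δ₀ * P.L) * (1 + P.L) ^ 2) * Real.exp (-(δ₀ / 2 * (supDist b₁.src b₂.src : ℝ)))) ∧
      (∀ b₁ b₂ : PBond P j, |Cloc P j (ρ j / 4) b₁ b₂ - Cmat P j b₁ b₂| ≤
        MC * (Real.exp (4 * δ₀ * P.L) * (1 + P.L) ^ 2) * Real.exp (-(δ₀ / 2 / 4 * ρ j)) *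
          Real.exp (-(δ₀ / 2 * (supDist b₁.src b₂.src : ℝ)))) :=
    fun j hjk => cSide_of_cloc_estimates hMC hδ₀ (fun R b b' => HC P rfl rfl j inferInstance (by omega) R b b') (ρ j)
  rw [neg_mul]
  exact (abs_dk_sub_dkLoc_le hd hk ha hδ hδC hM (by positivity) hH ρ hρ hmono (fun j hjk => (hC j hjk).1)
    (fun j hjk => (hC j hjk).2.1) (fun j hjk => (hC j hjk).2.2) hfar).trans (le_of_eq (by ring))

/-! ## §5 (v1.2)  The printed schedule `ρ_j = r(e_j)` and the hypothesis-free all-tori form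

(2.2)–(2.3): `e_j = (L^jε)^{(4−d)/2}e`, `r(e_j) = |log e_j⁻¹|^r`; for `d ≤ 4` and `L ≥ 1`, `log e_j⁻¹ = log e_k⁻¹ + (k − j)·((4−d)/2)log L ≥ log e_k⁻¹`
(`j ≤ k`, p08's `log_inv_eK_eq_add` / `BIJ88Ineq547W1Prime.log_inv_eK_mono`, used BY NAME), so once `e_k < 1` every `r(e_j)`, `j ≤ k`, is positive and `r(e_k) ≤ r(e_j)`: the schedule hypotheses of
§§3–4 hold for the printed schedule `rSched`, and the smallness factor is `e^{−c·r(e_k)}` as printed in (2.7) and in the p. 282 displays. -/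

open BIJ88Sect2Statements (rLen eK)
open BIJ88Ineq547W1Prime (log_inv_eK_mono)
open BIJ85Prop12AllTori (prop12Printed_allTori)

/-- **the printed schedule is positive below `k`**: `0 < r(e_j)` for every `j ≤ k` once `log e_k⁻¹ > 0` (`e_k < 1`), `d ≤ 4`, `L ≥ 1`.
[cite: BalabanImbrieJaffe1988, (2.3) p.260] -/
theorem rSched_pos_of_le {L ε e r : ℝ} (hL : 1 ≤ L) (hε : 0 < ε) (he : 0 < e) {d : ℕ} (hd : d ≤ 4) {j k : ℕ} (hjk : j ≤ k)
    (hℓ : 0 < Real.log (eK L ε e d k)⁻¹) : 0 < rSched L ε e r d j := by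
  unfold rSched rLen
  exact Real.rpow_pos_of_pos (abs_pos.2 (ne_of_gt (lt_of_lt_of_le hℓ (log_inv_eK_mono hL hε he hd hjk)))) _

/-- **the printed schedule is non-increasing below `k`**: `r(e_k) ≤ r(e_j)` for `j ≤ k` once `log e_k⁻¹ > 0`, `0 ≤ r`, `d ≤ 4`, `L ≥ 1`
(the text's *"r(e_j)"* radii shrink along the induction since `e_j` grows, (2.2)–(2.3)). [cite: BalabanImbrieJaffe1988, (2.3) p.260] -/
theorem rSched_anti {L ε e r : ℝ} (hL : 1 ≤ L) (hε : 0 < ε) (he : 0 < e) (hr : 0 ≤ r) {d : ℕ} (hd : d ≤ 4) {j k : ℕ} (hjk : j ≤ k)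
    (hℓ : 0 < Real.log (eK L ε e d k)⁻¹) : rSched L ε e r d k ≤ rSched L ε e r d j := by
  unfold rSched rLen
  have hmono := log_inv_eK_mono hL hε he hd hjk
  rw [abs_of_pos hℓ, abs_of_pos (lt_of_lt_of_le hℓ hmono)]
  exact Real.rpow_le_rpow hℓ.le hmono hr

/-- **`𝒟_{k,loc}` IS CLOSE TO `𝒟_k` ON THE TORUS AT THE PRINTED SCHEDULE `ρ_j = r(e_j)` — smallness `e^{−c·r(e_k)}`**, NO hypothesis on the
kernels (per-tower [6I] Prop. 1.2 is bookkeeping, §3): for a torus of the series with `2 ≤ d ≤ 4` there are `R₀, c₀ ≥ 0, c > 0, δ′ > 0` (independent of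
`ε, e, r`) such that for every `k ≤ m + K` with `log e_k⁻¹ > 0` (small charge), every `r ≥ 0` and all `η`-bonds with `dist_k(b,b″) ≥ R₀`:
`|𝒟_k(b,b″) − 𝒟_{k,loc}(b,b″)| ≤ c₀·e^{−c·r(e_k)}·e^{−δ′dist_k(b,b″)}` — the p. 261 clause *"𝒟_{k,loc} is close to 𝒟_k"* with the printed (2.7)-type
smallness. [cite: BalabanImbrieJaffe1988, (2.13) p.261] -/
theorem close_dkLoc_dk_torus_rSched (hd : 2 ≤ P.d) (hd4 : P.d ≤ 4) :
    ∃ R₀ c₀ c δ' : ℝ, 0 < c ∧ 0 < δ' ∧ 0 ≤ c₀ ∧ ∀ (k : ℕ) (_ : k ≤ P.m + P.K) (ε e r : ℝ), 0 < ε → 0 < e → 0 ≤ r →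
      0 < Real.log (eK (P.L : ℝ) ε e P.d k)⁻¹ → ∀ (b b'' : PBond P 0), R₀ ≤ kdist (P := P) k b b'' →
        |DkE P ((P.eta k) ^ P.d) ((P.L : ℝ) ^ k) k (toE P (Pi.single b'' 1)) b -
            dkLocKer (P := P) ((P.eta k) ^ P.d) ((P.L : ℝ) ^ k) (rSched (P.L : ℝ) ε e r P.d) k b b''| ≤
          c₀ * Real.exp (-(c * rSched (P.L : ℝ) ε e r P.d k)) * Real.exp (-δ' * kdist (P := P) k b b'') := by
  obtain ⟨R₀, c₀, c, δ', hc, hδ', hc₀, H⟩ := close_dkLoc_dk_torus (P := P) hd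
  have hL : (1 : ℝ) ≤ P.L := by exact_mod_cast P.hL.2.le
  exact ⟨R₀, c₀, c, δ', hc, hδ', hc₀, fun k hk ε e r hε he hr hℓ b b'' hfar =>
    H k hk _ (fun j hj => rSched_pos_of_le hL hε he hd4 hj.le hℓ) (fun j hj => rSched_anti hL hε he hr hd4 hj.le hℓ) b b'' hfar⟩

/-- **`𝒟_{k,loc}` IS CLOSE TO `𝒟_k` OVER ALL TORI — HYPOTHESIS-FREE** (only `2 ≤ d`, `L` odd `> 1`): [6I] Prop. 1.2 over the all-tori index is
p19 gen 6's THEOREM `BIJ85Prop12AllTori.prop12Printed_allTori`, so §4 gives ONE `(R₀, c₀, c, δ′)` such that for EVERY torus `P` (`P.d = d`,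
`P.L = L`), every `k ≤ m + K`, every schedule with `0 < ρ_j`, `ρ_k ≤ ρ_j` (`j < k`) and all `b, b″` with `dist_k(b,b″) ≥ R₀`:
`|𝒟_k(b,b″) − 𝒟_{k,loc}(b,b″)| ≤ c₀e^{−cρ_k}e^{−δ′dist_k(b,b″)}`. [cite: BalabanImbrieJaffe1988, (2.13) p.261] -/
theorem close_dkLoc_dk_allTori {d L : ℕ} (hd : 2 ≤ d) (hL : Odd L ∧ 1 < L) :
    ∃ R₀ c₀ c δ' : ℝ, 0 < c ∧ 0 < δ' ∧ 0 ≤ c₀ ∧ ∀ (P : Params) (_ : P.d = d) (_ : P.L = L) (k : ℕ) (_ : k ≤ P.m + P.K)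
      (ρ : ℕ → ℝ), (∀ j < k, 0 < ρ j) → (∀ j < k, ρ k ≤ ρ j) → ∀ (b b'' : PBond P 0), R₀ ≤ kdist (P := P) k b b'' →
        |DkE P ((P.eta k) ^ P.d) ((P.L : ℝ) ^ k) k (toE P (Pi.single b'' 1)) b -
            dkLocKer (P := P) ((P.eta k) ^ P.d) ((P.L : ℝ) ^ k) ρ k b b''| ≤
          c₀ * Real.exp (-(c * ρ k)) * Real.exp (-δ' * kdist (P := P) k b b'') :=
  close_dkLoc_dk_allTori_of_prop12Printed hd hL one_pos (prop12Printed_allTori d L one_pos)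

/-- **`𝒟_{k,loc}` IS CLOSE TO `𝒟_k` OVER ALL TORI AT THE PRINTED SCHEDULE — HYPOTHESIS-FREE** (`2 ≤ d ≤ 4`, `L` odd `> 1`): ONE `(R₀, c₀, c, δ′)`
for every torus `P` (`P.d = d`, `P.L = L`), every `k ≤ m + K` with `log e_k⁻¹ > 0`, every `ε, e > 0`, `r ≥ 0` and all `b, b″` with
`dist_k(b,b″) ≥ R₀`: `|𝒟_k(b,b″) − 𝒟_{k,loc}(b,b″)| ≤ c₀·e^{−c·r(e_k)}·e^{−δ′dist_k(b,b″)}` — the printed uniformity («uniformly in k» and in the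
volume) with the printed smallness. [cite: BalabanImbrieJaffe1988, (2.13) p.261] -/
theorem close_dkLoc_dk_allTori_rSched {d L : ℕ} (hd : 2 ≤ d) (hd4 : d ≤ 4) (hL : Odd L ∧ 1 < L) :
    ∃ R₀ c₀ c δ' : ℝ, 0 < c ∧ 0 < δ' ∧ 0 ≤ c₀ ∧ ∀ (P : Params) (_ : P.d = d) (_ : P.L = L) (k : ℕ) (_ : k ≤ P.m + P.K)
      (ε e r : ℝ), 0 < ε → 0 < e → 0 ≤ r → 0 < Real.log (eK (P.L : ℝ) ε e P.d k)⁻¹ →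
      ∀ (b b'' : PBond P 0), R₀ ≤ kdist (P := P) k b b'' →
        |DkE P ((P.eta k) ^ P.d) ((P.L : ℝ) ^ k) k (toE P (Pi.single b'' 1)) b -
            dkLocKer (P := P) ((P.eta k) ^ P.d) ((P.L : ℝ) ^ k) (rSched (P.L : ℝ) ε e r P.d) k b b''| ≤
          c₀ * Real.exp (-(c * rSched (P.L : ℝ) ε e r P.d k)) * Real.exp (-δ' * kdist (P := P) k b b'') := by
  obtain ⟨R₀, c₀, c, δ', hc, hδ', hc₀, H⟩ := close_dkLoc_dk_allTori hd hL
  refine ⟨R₀, c₀, c, δ', hc, hδ', hc₀, fun P hPd hPL k hk ε e r hε he hr hℓ b b'' hfar => ?_⟩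
  have hL1 : (1 : ℝ) ≤ P.L := by exact_mod_cast P.hL.2.le
  have hd4' : P.d ≤ 4 := hPd ▸ hd4
  exact H P hPd hPL k hk _ (fun j hj => rSched_pos_of_le hL1 hε he hd4' hj.le hℓ)
    (fun j hj => rSched_anti hL1 hε he hr hd4' hj.le hℓ) b b'' hfar

end

end Literature.MathematicalPhysics.QuantumFieldTheory.BalabanImbrieJaffe1984to88.BIJ88CurlyDkLocCloseTorus
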